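import Summits.CriticalPhenomena.Ising3DConformalLimit.Theses.SynchronousCoupling
import Summits.CriticalPhenomena.Ising3DConformalLimit.Theorems.HyperoctahedralRPLimitRotationInvariant
import Summits.CriticalPhenomena.Ising3DConformalLimit.Theorems.HyperoctahedralRPHRP2Rigidity
import Summits.CriticalPhenomena.Ising3DConformalLimit.Theorems.ExistsScaleCovariantLimit.Negative.DyadicIdentity
import HarnessLib

/-!
# `JoiningsTransfer` (item stmt-CriticalPhenomena-18764) cannot be refuted short of the summit conjunct

Negative / structural knowledge for the crux
`Summit.CriticalPhenomena.Ising3DConformalLimit.Theses.SynchronousCoupling.JoiningsTransfer`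
(`DilationJoinings → RotationJoining → UniformRegularity → (PL) ∧ (ROT)`; standing crux disprover,
cycle 1, D-0016); THEOREM-ONLY, no definitions, no named facts. No theorem here asserts a route item.

* `not_ising3DConformalLimit_of_not_joiningsTransfer` — **a refutation of the crux is a refutation of
  the summit conjunct `Ising3DConformalLimit`**: (ROT) is the landed `LimitRotationInvariant_of
  HRP2Rigidity_of` (items 1980 + 1979), and (PL) follows from ANY witness `(ρ, Δ, S)` of the summit by
  re-pinning (`hasPointwiseScalingLimit_rhoPin`: the `ρ★`-renormalised zoom converges along the full
  filter to `S₂(0,e₀)^{-n/2}·S`), whatever the three hypotheses say. Consequently no finite or certified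
  computation can falsify the crux, and every dropped-hypothesis variant of it is equally irrefutable here.
* `not_joiningsTransfer_iff` — what a disproof must deliver: `¬JT ↔ DJ ∧ RJ ∧ UR ∧ ¬PL` (prove both
  joinings AND item 4658, and refute item 6153 = (PL), written inline).

The informative negative content of the disproof lives one level up, on the abstract transfer skeleton:
`Negative/TwoBaseCroftMutations.lean` (p158811). [folklore]
-/

noncomputable section

namespace Summit.CriticalPhenomena.Ising3DConformalLimit.JoiningsTransferNegative

open Literature.Probability.LatticeModels Filter Set
open scoped Topology
open Summit.CriticalPhenomena.Ising3DConformalLimit.Theses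
open Summit.CriticalPhenomena.Ising3DConformalLimit.Theses.SynchronousCoupling
open Summit.CriticalPhenomena.Ising3DConformalLimit.MoebiusLimitExistsOnlyInteraction (rhoPin)

/-- **Irrefutability.** `¬ JoiningsTransfer → ¬ Ising3DConformalLimit`. [folklore] -/
theorem not_ising3DConformalLimit_of_not_joiningsTransfer (h : ¬ JoiningsTransfer) :
    ¬ _root_.Ising3DConformalLimit := by
  rintro ⟨ρ, Δ, S', hρ, -, hlim', hnd', -, -⟩
  refine h fun _ _ _ => ⟨fun n x hx => ?_,
    Cruxes.LimitRotationInvariant.QuarterTurnLiouville.LimitRotationInvariant_of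
      Cruxes.HRP2Rigidity.XRayMellin.HRP2Rigidity_of⟩
  have hlim := ExistsScaleCovariantLimitNegative.Dyadic.hasPointwiseScalingLimit_rhoPin hρ hlim' hnd'
  have hpin : (fun δ : ℝ => (criticalTwoPoint 3 (Pi.single 0 ⌊δ⁻¹⌋)) ^ (-(1/2:ℝ))) = rhoPin := by
    funext δ; simp only [rhoPin, one_div]
  rw [hpin]
  exact ⟨_, (hlim n).tendsto_at hx⟩

/-- **What a disproof must deliver**: `¬JT ↔ DJ ∧ RJ ∧ UR ∧ ¬PL` ((ROT) being a theorem). [folklore] -/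
theorem not_joiningsTransfer_iff : ¬ JoiningsTransfer ↔
    (DilationJoinings ∧ RotationJoining ∧ SynchronousCoupling.UniformRegularity ∧
      ¬ (∀ (n : ℕ), ∀ x ∈ NonCoincident 3 n, ∃ l : ℝ, Tendsto (fun δ : ℝ => rescaledCorrelator (criticalCorr 3)
        (fun δ : ℝ => (criticalTwoPoint 3 (Pi.single 0 ⌊δ⁻¹⌋)) ^ (-(1/2:ℝ))) n δ x) (𝓝[>] 0) (𝓝 l))) := by
  have hrot := Cruxes.LimitRotationInvariant.QuarterTurnLiouville.LimitRotationInvariant_of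
      Cruxes.HRP2Rigidity.XRayMellin.HRP2Rigidity_of
  constructor
  · intro h
    by_contra h'
    exact h fun hDJ hRJ hUR => ⟨Classical.by_contradiction fun hPL => h' ⟨hDJ, hRJ, hUR, hPL⟩, hrot⟩
  · rintro ⟨hDJ, hRJ, hUR, hPL⟩ h
    exact hPL (h hDJ hRJ hUR).1

end Summit.CriticalPhenomena.Ising3DConformalLimit.JoiningsTransferNegative

end
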